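import Summits.Ventures.LatticeQCDFlow.Scoring.CloverChargeMeanZero
import Literature.MathematicalPhysics.QuantumFieldTheory.WilsonFlow
import Literature.MathematicalPhysics.QuantumFieldTheory.FariaDaVeigaOCarroll2022.FdVOC22MultiReflectionBound
import HarnessLib

/-!
# The Wilson flow commutes with the time reflection of the torus, hence `⟨Q(V_t)⟩ = 0` for the FLOWED clover charge at every flow time

HONEST FRAMING: exact (Metropolis-corrected) sampling algorithms for lattice gauge theory;
figures of merit are autocorrelation/cost numbers at stated couplings and volumes; no
continuum-physics claim.

Venture `LatticeQCDFlow` (cell pub-lqcd), sub-topic `Scoring`; FANOUT row 16 (`su2-base`: the 4-d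
`SU(2)` baselines are scored on `τ_int(Q)` with `Q` the clover charge measured AFTER Wilson flow).
NEW WORK of the cell (placement rule), sequel of `Scoring/CloverChargeMeanZero.lean` (the bare charge),
over the Literature's rigorous `SU(n)` Wilson flow on the torus
(`QuantumFieldTheory/WilsonFlow.lean`: `wilsonFlow t U`, Lüscher's flow equation
`V̇_t(x,μ) = −P(Ω_{x,μ}(V_t)) V_t(x,μ)` with global existence/uniqueness `IsWilsonFlowLine.eq_wilsonFlow`,
gauge and translation covariance — that file lists "covariance under lattice rotations/reflections"
as NOT there), the site time reflection `Θ' = GaugeConfig.negReflect` of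
`ConstructiveQFTWave0SiteRPProofs` (`θ'(t, x⃗) = (−t, x⃗)`, temporal links traversed backwards) with
the plaquette bookkeeping of `WilsonSiteRP` / `FariaDaVeigaOCarroll2022.plaquetteHolonomy_negReflect_spatial`,
and the clover pseudoscalar `cloverPseudoscalar` (`QuantumLattice/CloverPseudoscalar`).  Nothing is cited
as a fact.  Printed counterpart, NAMED ONLY: Lüscher, JHEP 08 (2010) 071, §1–§3 (the flow preserves
the symmetries of the lattice theory; the flowed charge is a pseudoscalar).

## What is proved (torus `(ℤ/L)^d`, every `d ≥ 1`, `n`, `L`; §4 for `d = 4`, `L ≥ 1`)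

* §1 site/link bookkeeping of `θ'` (`sub_single_shift`, `negReflect_sub_single_of_ne`,
  `negReflect_sub_single_zero`) and, for ANY group `G`, the temporal plaquettes and the "lower" loops of
  the reflected configuration (`plaquetteHolonomy_negReflect_zero_left/right(_inv)`,
  `lowerLoop_negReflect_zero/of_ne/temporal`): every loop of `Θ'U` through a link is a loop of `U`
  through the reflected link, conjugated and/or reversed.
* §2 (`SU(n)`) **`plaquetteLoopSum_negReflect_of_ne`**: `Ω_{x,μ}(Θ'V) = Ω_{θ'x,μ}(V)` for a spatial link
  (the upper and lower temporal plaquettes trade places); **`plaquetteLoopSum_negReflect_zero`**: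
  `Ω_{x,0}(Θ'V) = A† Ω_{y,0}(V)† A`, `y = θ'(x + e₀)`, `A = V(y, 0)` (a temporal link is read backwards
  from its far end); `suProj_conjTranspose_eq_neg` (`P(W†) = −P(W)`); hence the vector field
  **`wilsonFlowVF_negReflect_of_ne`** (`Z(Θ'V)(x,μ) = Z(V)(θ'x,μ)`) and **`wilsonFlowVF_negReflect_zero`**
  (`Z(Θ'V)(x,0) = Z(V)(y,0)†`, using `P(gWg†) = gP(W)g†` and `P† = −P`).
* §3 **`wilsonFlow_negReflect`**: `V_t(Θ'U) = Θ'(V_t U)` for every real `t` — `t ↦ Θ'(V_t U)` solves the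
  flow equation through `Θ'U` (spatial links: §2 verbatim; temporal links: the derivative of
  `s ↦ V_s(y,0)†` is the adjoint of the velocity), so it IS the flow by uniqueness.
* §4 (`d = 4`) `sum_cloverPseudoscalar_wilsonFlow_negReflect`: the flowed total clover charge
  `Q_t(U) = Σ_x P_x(V_t U)` is `Θ'`-odd; **`wilsonExpectation_flowedCloverCharge_eq_zero`**: for the
  Wilson theory of `SU(n)` in the fundamental representation on `(ℤ/L)^4`, EVERY real `β`, every
  `L ≥ 1` and EVERY flow time `t ∈ ℝ`, `⟨Σ_x P_x(V_t)⟩_{Λ,β} = 0` (`P_x` = the clover `F F̃` density up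
  to `1/(8π²)`; row 16's observable at `n = 2`, the `SU(3)` rows' at `n = 3`).

NOT CLAIMED: covariance under the full hypercubic group (rotations, spatial reflections — same
method, not needed here); the `U(N)` / general-`G` matrix-level flow of `QuantumLattice/LatticeWilsonFlow`
(whose flow is not yet known in the tree to stay in `ρ(G)`); cooling or stout smearing instead of the
flow; anything about `⟨Q_t²⟩`, `τ_int`, integrality of `Q_t`, or the `t → ∞` limit; any number.
-/

noncomputable section

open Matrix MeasureTheory
open Literature.MathematicalPhysics.QuantumFieldTheory
open Literature.MathematicalPhysics.QuantumLattice (fundamentalRep continuous_fundamentalRep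
  fundamentalRep_mem_unitaryGroup cloverPseudoscalar)
open scoped Matrix.Norms.Frobenius

namespace Summit.Ventures.LatticeQCDFlow.Scoring

/-! ## §1 Sites, links and plaquettes under the site reflection `θ'` -/

section Sites

variable {d L : ℕ}

/-- Shifts and backward steps commute: `(x − ν̂) + μ̂ = (x + μ̂) − ν̂`. -/
theorem sub_single_shift (x : Site d L) (ν μ : Fin d) :
    (x - Pi.single ν 1).shift μ = x.shift μ - Pi.single ν 1 := by
  simp only [Site.shift]
  abel

variable [NeZero d]

/-- `θ'` commutes with backward spatial steps: `θ'(x − ν̂) = θ'x − ν̂` for `ν ≠ 0`. -/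
theorem negReflect_sub_single_of_ne (x : Site d L) {ν : Fin d} (hν : ν ≠ 0) :
    (x - Pi.single ν 1).negReflect = x.negReflect - Pi.single ν 1 := by
  have h := WilsonSiteRP.negReflect_shift_of_ne (x - Pi.single ν 1) hν
  rw [shift_sub_single] at h
  rw [h, Site.shift, add_sub_cancel_right]

/-- `θ'x − e₀ = θ'(x + e₀)`: the backward temporal neighbour of the reflected site. -/
theorem negReflect_sub_single_zero (x : Site d L) :
    x.negReflect - Pi.single 0 1 = (x.shift 0).negReflect := by
  have h := WilsonSiteRP.negReflect_shift_shift (d := d) (L := L) x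
  rw [← h, Site.shift, add_sub_cancel_right]

end Sites

section Plaquettes

variable {d L : ℕ} [NeZero d] {G : Type*} [Group G]

/-- `(Θ'U)(x, 0) = U(θ'(x + e₀), 0)⁻¹`, with the temporal neighbour written as `x.shift 0` (the form
produced by unfolding `plaquetteHolonomy`; `Scoring.negReflect_apply_zero` is the additive spelling). -/
theorem negReflect_apply_zero_shift (U : GaugeConfig d L G) (x : Site d L) :
    U.negReflect (x, 0) = (U ((x.shift 0).negReflect, 0))⁻¹ := rfl

/-- **Temporal plaquette `(0, j)` of the reflected configuration**: with `y = θ'(x + e₀)`,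
`(Θ'U)_{x;0j} = U(y,0)⁻¹ · U_{y;j0} · U(y,0)` — the REVERSED temporal plaquette of `U` at `y`, transported
along the temporal link. -/
theorem plaquetteHolonomy_negReflect_zero_left (U : GaugeConfig d L G) (x : Site d L) {j : Fin d}
    (hj : j ≠ 0) :
    plaquetteHolonomy U.negReflect x 0 j =
      (U ((x.shift 0).negReflect, 0))⁻¹ * plaquetteHolonomy U (x.shift 0).negReflect j 0 *
        U ((x.shift 0).negReflect, 0) := by
  unfold plaquetteHolonomy
  simp only [WilsonSiteRP.negReflect_apply, WilsonSiteRP.siteEdgeReflect, hj, ↓reduceIte]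
  rw [WilsonSiteRP.negReflect_shift_shift_zero _ hj, ← WilsonSiteRP.negReflect_shift_shift x]
  set y := (x.shift 0).negReflect
  group

/-- The same plaquette written with an inverse: `(Θ'U)_{x;0j} = U(y,0)⁻¹ · (U_{y;0j})⁻¹ · U(y,0)`. -/
theorem plaquetteHolonomy_negReflect_zero_left_inv (U : GaugeConfig d L G) (x : Site d L) {j : Fin d}
    (hj : j ≠ 0) :
    plaquetteHolonomy U.negReflect x 0 j =
      (U ((x.shift 0).negReflect, 0))⁻¹ * (plaquetteHolonomy U (x.shift 0).negReflect 0 j)⁻¹ *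
        U ((x.shift 0).negReflect, 0) := by
  rw [plaquetteHolonomy_negReflect_zero_left U x hj]
  unfold plaquetteHolonomy
  group

/-- **Temporal plaquette `(j, 0)` of the reflected configuration**: `(Θ'U)_{x;j0} = U(y,0)⁻¹ · U_{y;0j} · U(y,0)`,
`y = θ'(x + e₀)`. -/
theorem plaquetteHolonomy_negReflect_zero_right (U : GaugeConfig d L G) (x : Site d L) {j : Fin d}
    (hj : j ≠ 0) :
    plaquetteHolonomy U.negReflect x j 0 =
      (U ((x.shift 0).negReflect, 0))⁻¹ * plaquetteHolonomy U (x.shift 0).negReflect 0 j *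
        U ((x.shift 0).negReflect, 0) := by
  unfold plaquetteHolonomy
  simp only [WilsonSiteRP.negReflect_apply, WilsonSiteRP.siteEdgeReflect, hj, ↓reduceIte]
  rw [WilsonSiteRP.negReflect_shift_shift_zero _ hj, ← WilsonSiteRP.negReflect_shift_shift x]
  set y := (x.shift 0).negReflect
  group

/-- The same, based at `θ'x`: `(Θ'U)_{x;μ0}` is the LOWER temporal loop of `U` through `(θ'x, μ)`. -/
theorem plaquetteHolonomy_negReflect_zero_right' (U : GaugeConfig d L G) (x : Site d L) {μ : Fin d}
    (hμ : μ ≠ 0) :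
    plaquetteHolonomy U.negReflect x μ 0 =
      (U (x.negReflect - Pi.single 0 1, 0))⁻¹ * plaquetteHolonomy U (x.negReflect - Pi.single 0 1) 0 μ *
        U (x.negReflect - Pi.single 0 1, 0) := by
  rw [plaquetteHolonomy_negReflect_zero_right U x hμ, negReflect_sub_single_zero]

/-- The lower temporal loop of `Θ'U` through the spatial link `(x, μ)` is the UPPER temporal plaquette of
`U` at `θ'x`. -/
theorem lowerLoop_negReflect_zero (U : GaugeConfig d L G) (x : Site d L) {μ : Fin d} (hμ : μ ≠ 0) :
    (U.negReflect (x - Pi.single 0 1, 0))⁻¹ * plaquetteHolonomy U.negReflect (x - Pi.single 0 1) 0 μ *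
        U.negReflect (x - Pi.single 0 1, 0) = plaquetteHolonomy U x.negReflect μ 0 := by
  rw [plaquetteHolonomy_negReflect_zero_left U _ hμ, negReflect_apply_zero_shift, shift_sub_single]
  group

/-- The lower spatial loop of `Θ'U` through `(x, μ)` in a spatial direction `ν` is the lower loop of `U`
through `(θ'x, μ)`. -/
theorem lowerLoop_negReflect_of_ne (U : GaugeConfig d L G) (x : Site d L) {μ ν : Fin d} (hμ : μ ≠ 0)
    (hν : ν ≠ 0) :
    (U.negReflect (x - Pi.single ν 1, ν))⁻¹ * plaquetteHolonomy U.negReflect (x - Pi.single ν 1) ν μ *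
        U.negReflect (x - Pi.single ν 1, ν) =
      (U (x.negReflect - Pi.single ν 1, ν))⁻¹ *
        plaquetteHolonomy U (x.negReflect - Pi.single ν 1) ν μ * U (x.negReflect - Pi.single ν 1, ν) := by
  rw [negReflect_apply_of_ne U _ hν,
    FariaDaVeigaOCarroll2022.plaquetteHolonomy_negReflect_spatial U _ hν hμ, negReflect_sub_single_of_ne x hν]

/-- The lower loop of `Θ'U` through the TEMPORAL link `(x, 0)` in direction `ν`: the inverse of the lower
loop of `U` through `(y, 0)`, `y = θ'(x + e₀)`, transported along `U(y, 0)`. -/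
theorem lowerLoop_negReflect_temporal (U : GaugeConfig d L G) (x : Site d L) {ν : Fin d} (hν : ν ≠ 0) :
    (U.negReflect (x - Pi.single ν 1, ν))⁻¹ * plaquetteHolonomy U.negReflect (x - Pi.single ν 1) ν 0 *
        U.negReflect (x - Pi.single ν 1, ν) =
      (U ((x.shift 0).negReflect, 0))⁻¹ *
        ((U ((x.shift 0).negReflect - Pi.single ν 1, ν))⁻¹ *
          plaquetteHolonomy U ((x.shift 0).negReflect - Pi.single ν 1) ν 0 *
            U ((x.shift 0).negReflect - Pi.single ν 1, ν))⁻¹ * U ((x.shift 0).negReflect, 0) := by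
  rw [negReflect_apply_of_ne U _ hν, plaquetteHolonomy_negReflect_zero_right U _ hν,
    negReflect_sub_single_of_ne x hν, sub_single_shift, negReflect_sub_single_of_ne (x.shift 0) hν,
    ← WilsonSiteRP.negReflect_shift_shift x]
  set y := (x.shift 0).negReflect
  unfold plaquetteHolonomy
  rw [sub_single_shift y ν 0, shift_sub_single]
  group

end Plaquettes

/-! ## §2 The loop sums `Ω` and the flow vector field under `Θ'` (`SU(n)`) -/

section VectorField

variable {d L n : ℕ} [NeZero d]

/-- **`Ω` through a spatial link is carried along**: `Ω_{x,μ}(Θ'V) = Ω_{θ'x,μ}(V)` for `μ ≠ 0` (spatial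
plaquettes go to spatial plaquettes; the upper and lower temporal plaquettes through the link trade
places, so their sum is unchanged). -/
theorem plaquetteLoopSum_negReflect_of_ne (V : GaugeConfig d L (Matrix.specialUnitaryGroup (Fin n) ℂ))
    (x : Site d L) {μ : Fin d} (hμ : μ ≠ 0) :
    plaquetteLoopSum V.negReflect x μ = plaquetteLoopSum V x.negReflect μ := by
  unfold plaquetteLoopSum
  refine Finset.sum_congr rfl fun ν _ => ?_
  by_cases hνμ : ν = μ
  · rw [if_pos hνμ, if_pos hνμ]
  rw [if_neg hνμ, if_neg hνμ]
  by_cases hν : ν = 0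
  · subst hν
    rw [add_comm, lowerLoop_negReflect_zero V x hμ, plaquetteHolonomy_negReflect_zero_right' V x hμ]
  · rw [FariaDaVeigaOCarroll2022.plaquetteHolonomy_negReflect_spatial V x hμ hν,
      lowerLoop_negReflect_of_ne V x hμ hν]

/-- **`Ω` through a temporal link is read backwards from the far end**:
`Ω_{x,0}(Θ'V) = A† · Ω_{y,0}(V)† · A` with `y = θ'(x + e₀)` and `A = V(y, 0)` (every loop of `Θ'V`
through `(x, 0)` is the reversal of a loop of `V` through `(y, 0)`, re-based at the other end of the
link). -/
theorem plaquetteLoopSum_negReflect_zero (V : GaugeConfig d L (Matrix.specialUnitaryGroup (Fin n) ℂ))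
    (x : Site d L) :
    plaquetteLoopSum V.negReflect x 0 =
      ((V ((x.shift 0).negReflect, 0) : Matrix.specialUnitaryGroup (Fin n) ℂ) :
          Matrix (Fin n) (Fin n) ℂ)ᴴ * (plaquetteLoopSum V (x.shift 0).negReflect 0)ᴴ *
        ((V ((x.shift 0).negReflect, 0) : Matrix.specialUnitaryGroup (Fin n) ℂ) :
          Matrix (Fin n) (Fin n) ℂ) := by
  unfold plaquetteLoopSum
  rw [Matrix.conjTranspose_sum, Finset.mul_sum, Finset.sum_mul]
  refine Finset.sum_congr rfl fun ν _ => ?_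
  by_cases hν : ν = 0
  · rw [if_pos hν, if_pos hν, Matrix.conjTranspose_zero, Matrix.mul_zero, Matrix.zero_mul]
  rw [if_neg hν, if_neg hν, plaquetteHolonomy_negReflect_zero_left_inv V x hν,
    lowerLoop_negReflect_temporal V x hν]
  simp only [WilsonFlow.coe_mul_SU, WilsonFlow.coe_inv_SU, Matrix.conjTranspose_add, Matrix.mul_add,
    Matrix.add_mul, Matrix.mul_assoc]

/-- `P(W†) = −P(W)` for Lüscher's projector `P` onto the traceless anti-Hermitian part. -/
theorem suProj_conjTranspose_eq_neg (W : Matrix (Fin n) (Fin n) ℂ) : suProj Wᴴ = -suProj W := by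
  have h : Wᴴ - Wᴴᴴ = -(W - Wᴴ) := by rw [Matrix.conjTranspose_conjTranspose, neg_sub]
  rw [suProj, suProj, h, Matrix.trace_neg, smul_neg, mul_neg, neg_smul, neg_sub]
  abel

/-- **The flow vector field on a spatial link is carried along**: `Z(Θ'V)(x, μ) = Z(V)(θ'x, μ)`, `μ ≠ 0`. -/
theorem wilsonFlowVF_negReflect_of_ne (V : GaugeConfig d L (Matrix.specialUnitaryGroup (Fin n) ℂ))
    (x : Site d L) {μ : Fin d} (hμ : μ ≠ 0) :
    wilsonFlowVF V.negReflect (x, μ) = wilsonFlowVF V (x.negReflect, μ) := by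
  simp only [wilsonFlowVF]
  rw [plaquetteLoopSum_negReflect_of_ne V x hμ, negReflect_apply_of_ne V x hμ]

/-- **The flow vector field on a temporal link is the adjoint of the one on the reflected link**:
`Z(Θ'V)(x, 0) = Z(V)(y, 0)†`, `y = θ'(x + e₀)` — from `Ω_{x,0}(Θ'V) = A†Ω†A`, `P(gWg†) = gP(W)g†` for
unitary `g` (`suProj_unitary_conj`), `P(W†) = −P(W)`, `P† = −P` and `AA† = 1`. -/
theorem wilsonFlowVF_negReflect_zero (V : GaugeConfig d L (Matrix.specialUnitaryGroup (Fin n) ℂ))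
    (x : Site d L) :
    wilsonFlowVF V.negReflect (x, 0) = (wilsonFlowVF V ((x.shift 0).negReflect, 0))ᴴ := by
  simp only [wilsonFlowVF]
  set A : Matrix (Fin n) (Fin n) ℂ :=
    ((V ((x.shift 0).negReflect, 0) : Matrix.specialUnitaryGroup (Fin n) ℂ) : Matrix (Fin n) (Fin n) ℂ)
    with hA
  set Ω := plaquetteLoopSum V (x.shift 0).negReflect 0 with hΩ
  have hAu : A ∈ Matrix.unitaryGroup (Fin n) ℂ := (V ((x.shift 0).negReflect, 0)).2.1
  have hg : star A ∈ Matrix.unitaryGroup (Fin n) ℂ := Unitary.star_mem hAu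
  have key := suProj_unitary_conj hg Ωᴴ
  rw [star_star, Matrix.star_eq_conjTranspose, suProj_conjTranspose_eq_neg] at key
  have hAA : A * Aᴴ = 1 := WilsonFlow.mul_conjTranspose_self_SU _
  rw [plaquetteLoopSum_negReflect_zero, negReflect_apply_zero_shift, WilsonFlow.coe_inv_SU, ← hA, ← hΩ,
    key, Matrix.conjTranspose_mul, Matrix.conjTranspose_neg, conjTranspose_suProj]
  simp only [Matrix.mul_neg, Matrix.neg_mul, neg_neg, Matrix.mul_assoc, hAA, Matrix.mul_one]

end VectorField

/-! ## §3 Reflection covariance of the Wilson flow -/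

section Flow

variable {d L n : ℕ} [NeZero d] [NeZero L]

/-- **The Wilson flow commutes with the time reflection**: `V_t(Θ'U) = Θ'(V_t U)` for every `SU(n)`
configuration `U` of the torus `(ℤ/L)^d` and every real flow time `t`.  Proof: `t ↦ Θ'(V_t U)` is a
global flow line through `Θ'U` — on spatial links by `wilsonFlowVF_negReflect_of_ne`, on temporal links
because `s ↦ V_s(y,0)†` has velocity `Z(V_s)(y,0)† = Z(Θ'V_s)(x,0)` (`wilsonFlowVF_negReflect_zero`) —
and global flow lines are unique (`IsWilsonFlowLine.eq_wilsonFlow`). -/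
theorem wilsonFlow_negReflect (t : ℝ) (U : GaugeConfig d L (Matrix.specialUnitaryGroup (Fin n) ℂ)) :
    wilsonFlow t U.negReflect = (wilsonFlow t U).negReflect := by
  have h : IsWilsonFlowLine U.negReflect (fun t => (wilsonFlow t U).negReflect) := by
    refine ⟨by simp only [wilsonFlow_zero], fun t e i j => ?_⟩
    obtain ⟨x, μ⟩ := e
    show HasDerivAt (fun s => (((wilsonFlow s U).negReflect (x, μ) : Matrix.specialUnitaryGroup (Fin n) ℂ) :
        Matrix (Fin n) (Fin n) ℂ) i j) (wilsonFlowVF (wilsonFlow t U).negReflect (x, μ) i j) t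
    by_cases hμ : μ = 0
    · subst hμ
      have hW : HasDerivAt
          (fun s => ((wilsonFlow s U ((x.shift 0).negReflect, 0) : Matrix.specialUnitaryGroup (Fin n) ℂ) :
            Matrix (Fin n) (Fin n) ℂ))
          (wilsonFlowVF (wilsonFlow t U) ((x.shift 0).negReflect, 0)) t :=
        WilsonFlow.hasDerivAt_of_entries fun i j => hasDerivAt_wilsonFlow U t _ i j
      have h2 := hW.star
      rw [Matrix.star_eq_conjTranspose, ← wilsonFlowVF_negReflect_zero] at h2
      have hfun : (fun s => (((wilsonFlow s U).negReflect (x, 0) : Matrix.specialUnitaryGroup (Fin n) ℂ) :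
            Matrix (Fin n) (Fin n) ℂ) i j) =
          fun s => (star ((wilsonFlow s U ((x.shift 0).negReflect, 0) :
            Matrix.specialUnitaryGroup (Fin n) ℂ) : Matrix (Fin n) (Fin n) ℂ)) i j := by
        funext s
        rw [negReflect_apply_zero_shift, WilsonFlow.coe_inv_SU, Matrix.star_eq_conjTranspose]
      rw [hfun]
      exact WilsonFlow.hasDerivAt_entry h2 i j
    · have hfun : (fun s => (((wilsonFlow s U).negReflect (x, μ) : Matrix.specialUnitaryGroup (Fin n) ℂ) :
            Matrix (Fin n) (Fin n) ℂ) i j) =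
          fun s => ((wilsonFlow s U (x.negReflect, μ) : Matrix.specialUnitaryGroup (Fin n) ℂ) :
            Matrix (Fin n) (Fin n) ℂ) i j := by
        funext s
        rw [negReflect_apply_of_ne _ _ hμ]
      rw [hfun, wilsonFlowVF_negReflect_of_ne _ _ hμ]
      exact hasDerivAt_wilsonFlow U t (x.negReflect, μ) i j
  exact (h.eq_wilsonFlow t).symm

end Flow

/-! ## §4 The flowed clover charge has zero Wilson mean at every flow time -/

section FlowedCharge

variable {L n : ℕ} [NeZero L]

/-- **The flowed total clover charge is reflection-odd**: `Q_t(Θ'U) = −Q_t(U)` with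
`Q_t(U) = Σ_x P_x(V_t U)`, `P_x = cloverPseudoscalar` of the flowed `SU(n)` configuration read in the
fundamental representation (flow covariance + `sum_cloverPseudoscalar_negReflect`). -/
theorem sum_cloverPseudoscalar_wilsonFlow_negReflect (t : ℝ)
    (U : GaugeConfig 4 L (Matrix.specialUnitaryGroup (Fin n) ℂ)) :
    ∑ x : Site 4 L, cloverPseudoscalar (fundamentalRep (Fin n)) x (wilsonFlow t U.negReflect) =
      -∑ x : Site 4 L, cloverPseudoscalar (fundamentalRep (Fin n)) x (wilsonFlow t U) := by
  rw [wilsonFlow_negReflect]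
  exact sum_cloverPseudoscalar_negReflect (fundamentalRep (Fin n)) fundamentalRep_mem_unitaryGroup _

/-- **`⟨Q(V_t)⟩_{Λ,β} = 0` at every flow time.**  For the Wilson theory of `SU(n)` (fundamental
representation) on the torus `(ℤ/L)^4`, every `L ≥ 1`, EVERY real `β` and EVERY real flow time `t`,
the Wilson-measure mean of the total clover charge of the flowed configuration `V_t = wilsonFlow t U`
(`8π²` times the flowed clover topological charge) vanishes: the observable is odd under the
measure-preserving time reflection `Θ'` (`wilsonExpectation_eq_zero_of_negReflect_odd`).  Row 16's
`⟨Q⟩ = 0` run check (`n = 2`) and the `SU(3)` rows' (`n = 3`) as a theorem about the target. -/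
theorem wilsonExpectation_flowedCloverCharge_eq_zero (n : ℕ) (β t : ℝ) :
    wilsonExpectation (fundamentalRep (Fin n)) β
      (fun U : GaugeConfig 4 L (Matrix.specialUnitaryGroup (Fin n) ℂ) =>
        ∑ x : Site 4 L, cloverPseudoscalar (fundamentalRep (Fin n)) x (wilsonFlow t U)) = 0 :=
  wilsonExpectation_eq_zero_of_negReflect_odd (fundamentalRep (Fin n)) (continuous_fundamentalRep (Fin n)) β
    fun U => sum_cloverPseudoscalar_wilsonFlow_negReflect t U

end FlowedCharge

end Summit.Ventures.LatticeQCDFlow.Scoring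

end
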